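import Summits.CriticalPhenomena.CardyFormulaZ2.Theorems.CardySusyWardDiscretisationFamilyExistsCover
import HarnessLib

/-!
# No forced site at a cut edge with a short opposite radius: helper for `DiscretisationFamilyExists` (stmt-CriticalPhenomena-9644)

Companion of the covering lemma (`…DiscretisationFamilyExistsCover.lean`).  In a labelling
`zdBoundary = S_A ⊔ S_B` whose bichromatic `Ω_δ`-edges are the two cut edges only, the no-forcing
condition of `zdDiscretisationFamily_of_labelling` is automatic off the cut edges; this file treats an
ENDPOINT `u` of a cut edge `{u, v}`, `v = u + cornerUnit m`, under the hypothesis that the opposite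
endpoint has a short radius, `infDist (δv) ∂Ω ≤ δ`:

* `not_closedBall_subset_of_cut`: if `v` is the only site of `X = S_B` joined to `u` by an edge of
  `Ω_δ`, no other site of `zdBoundary ∖ X` within `δ` of `u` has an `Ω_δ`-neighbour in `X`, the cut
  edge is valid (its two faces `faceAt u m`, `faceAt u (m + 3)` are not both inner) and
  `infDist (δv) ∂Ω ≤ δ`, then `closedBall (δu) (infDist (δu) ∂Ω) ⊄ ⋃ x ∈ X, closedBall (δx) …`.
  Proof: the disc of `v` does not reach the points `δu + s·δd` for the two diagonal directions `d`
  pointing away from `v`, so by directional forcing (`add_diag_mem_of_cover`) both far diagonal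
  neighbours of `u` lie in `X` with empty discs of radius `δ√2`; the two far faces at `u` are then
  inner, the two perpendicular neighbours of `u` are joined in `Ω_δ` both to `u` and to a far
  diagonal site of `X`, so they are not boundary sites (either colour would create a third
  bichromatic edge), hence all faces around them are inner (`isInnerFace_faceAt_of_not_mem_zdBoundary`)
  — including both faces of the cut edge, which is absurd.
* `isInnerFace_faceAt_of_not_mem_zdBoundary`: at a vertex off `zdBoundary` one inner face makes all
  four faces inner.

What is NOT here: the existence, near each marked point, of a cut edge of the outer boundary
cycle to which this criterion (or a finer one) applies.
-/

noncomputable section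

open Set Metric Filter Topology
open Literature.Probability.LatticeModels Literature.Probability.Percolation

namespace Summit.CriticalPhenomena.CardyFormulaZ2.Theorems.DiscretisationFamilyExists

/-! ### `Fin 4` bookkeeping -/

/-- [folklore] -/
theorem fin4_add_one_ne (m : Fin 4) : m + 1 ≠ m := by revert m; decide

/-- The diagonal offset of face `m + 1`. [folklore] -/
theorem diag_succ (m : Fin 4) :
    cornerUnit (m + 1) + cornerUnit (m + 1 + 1) = cornerUnit (m + 1) + cornerUnit (m + 2) := by
  rw [fin4_add_one_add_one]

/-- The diagonal offset of face `m + 2`. [folklore] -/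
theorem diag_add_two (m : Fin 4) :
    cornerUnit (m + 2) + cornerUnit (m + 2 + 1) = cornerUnit (m + 2) + cornerUnit (m + 3) := by
  rw [fin4_add_two_add_one]

/-! ### Interior vertices -/

/-- **At a vertex off `zdBoundary`, one inner face makes all four faces inner**: consecutive faces
around the vertex share an edge of `Ω_δ` (a side of the inner one), which would be a face-boundary
edge if the other were not inner. [folklore] -/
theorem isInnerFace_faceAt_of_not_mem_zdBoundary {E : DiscreteDobrushin} {w : Site 2}
    (hw : w ∉ E.zdBoundary) {k : Fin 4} (hk : E.IsInnerFace (faceAt w k)) (j : Fin 4) :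
    E.IsInnerFace (faceAt w j) := by
  -- one step clockwise: face `k` inner ⇒ face `k + 3` inner
  have step : ∀ k, E.IsInnerFace (faceAt w k) → E.IsInnerFace (faceAt w (k + 3)) := by
    intro k hk
    by_contra hk3
    apply hw
    refine E.mem_zdBoundary_iff.2 (Or.inr ⟨w + cornerUnit k, ?_, ⟨_, hk, isCorner_faceAt w k,
      (isCorner_add_faceAt_iff w k k).2 (Or.inl rfl)⟩, ⟨_, hk3, isCorner_faceAt w (k + 3),
      (isCorner_add_faceAt_iff w k (k + 3)).2 (Or.inr rfl)⟩⟩)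
    exact hk w _ (isCorner_faceAt w k) ((isCorner_add_faceAt_iff w k k).2 (Or.inl rfl))
      (zdGraph_adj_add_cornerUnit w k)
  have h3 := step k hk
  have h2 : E.IsInnerFace (faceAt w (k + 2)) := fin4_add_three_add_three k ▸ step _ h3
  have h1 : E.IsInnerFace (faceAt w (k + 1)) := fin4_add_two_add_three k ▸ step _ h2
  -- `j` is one of `k, k+1, k+2, k+3`
  have hj : j = k ∨ j = k + 1 ∨ j = k + 2 ∨ j = k + 3 := by
    have : ∀ k j : Fin 4, j = k ∨ j = k + 1 ∨ j = k + 2 ∨ j = k + 3 := by decide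
    exact this k j
  rcases hj with rfl | rfl | rfl | rfl
  exacts [hk, h1, h2, h3]

/-! ### The disc of a neighbour with short radius misses the far diagonal directions -/

/-- Squared norm of `meshPoint δ a - s • meshPoint δ b` in coordinates. [folklore] -/
theorem norm_meshPoint_sub_smul_sq (δ s : ℝ) (a b : Site 2) :
    ‖meshPoint δ a - s • meshPoint δ b‖ ^ 2 =
      δ ^ 2 * (((a 0 : ℝ) - s * (b 0 : ℝ)) ^ 2 + ((a 1 : ℝ) - s * (b 1 : ℝ)) ^ 2) := by
  rw [← norm_neg, neg_sub, norm_smul_meshPoint_sub_sq]; ring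

/-- **The disc of a short neighbour misses the far diagonal rays.** If `v = u + cornerUnit m` has
`infDist (δv) ∂Ω ≤ δ`, then for the two diagonal directions `d = (cornerUnit (m + 1) + cornerUnit ((m + 1) + 1)), (cornerUnit (m + 2) + cornerUnit ((m + 2) + 1))`
pointing away from `v` and every `s > 0`, the point `δu + s·δd` is at distance `> infDist (δv) ∂Ω`
from `δv` (indeed at distance `δ√(1 + 2s + 2s²) > δ`). [folklore] -/
theorem infDist_lt_dist_far_diag {δ : ℝ} (hδ : 0 < δ) {Ω : Set ℂ} (u : Site 2) (m : Fin 4)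
    (hρv : infDist (meshPoint δ (u + cornerUnit m)) (frontier Ω) ≤ δ) {k : Fin 4}
    (hk : k = m + 1 ∨ k = m + 2) {s : ℝ} (hs : 0 < s) :
    infDist (meshPoint δ (u + cornerUnit m)) (frontier Ω) <
      dist (meshPoint δ (u + cornerUnit m)) (meshPoint δ u + s • meshPoint δ ((cornerUnit k + cornerUnit (k + 1)))) := by
  refine hρv.trans_lt ?_
  rw [dist_eq_norm, meshPoint_add, show meshPoint δ u + meshPoint δ (cornerUnit m) -
    (meshPoint δ u + s • meshPoint δ ((cornerUnit k + cornerUnit (k + 1)))) = meshPoint δ (cornerUnit m) - s • meshPoint δ ((cornerUnit k + cornerUnit (k + 1)))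
    by ring]
  have hsq : δ ^ 2 < ‖meshPoint δ (cornerUnit m) - s • meshPoint δ ((cornerUnit k + cornerUnit (k + 1)))‖ ^ 2 := by
    rw [norm_meshPoint_sub_smul_sq]
    have key : (1 : ℝ) < ((cornerUnit m 0 : ℝ) - s * ((cornerUnit k + cornerUnit (k + 1)) 0 : ℝ)) ^ 2 +
        ((cornerUnit m 1 : ℝ) - s * ((cornerUnit k + cornerUnit (k + 1)) 1 : ℝ)) ^ 2 := by
      rcases hk with rfl | rfl <;> fin_cases m <;>
        simp [cornerUnit, Pi.add_apply] <;> nlinarith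
    have hδ2 : 0 < δ ^ 2 := by positivity
    nlinarith
  exact lt_of_pow_lt_pow_left₀ 2 (norm_nonneg _) hsq

/-! ### The cut lemma -/

/-- **No forced endpoint at a cut edge whose opposite endpoint has a short radius.** Let `u` be a
boundary site, `X ∌ u` a finite set of boundary sites (the opposite colour class) and
`v = u + cornerUnit m` such that: `v` is the only site of `X` joined to `u` by an edge of `Ω_δ`;
no site of `zdBoundary ∖ X` other than `u` within `δ` of `u` has an `Ω_δ`-neighbour in `X` (in a
labelling whose bichromatic edges are two far-apart cut edges this holds); the edge `{u, v}` is
valid, i.e. its two faces `faceAt u m`, `faceAt u (m + 3)` are not both inner; and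
`infDist (δv) ∂Ω ≤ δ`.  Then the disc `closedBall (δu) (infDist (δu) ∂Ω)` is not covered by the
discs of `X`.  (Directional forcing in the two diagonal directions away from `v`, which the disc of
`v` cannot serve, puts both far diagonal neighbours of `u` in `X` with empty discs of radius `δ√2`;
then the two perpendicular neighbours of `u` are off `zdBoundary`, all faces around them are inner,
and so are both faces of the cut edge.) [folklore] -/
theorem not_closedBall_subset_of_cut {E : DiscreteDobrushin} (hΩ : IsOpen E.Ω) (hδ : 0 < E.δ)
    {u : Site 2} (hu : u ∈ E.zdBoundary) {X : Set (Site 2)} (hX : X ⊆ E.zdBoundary)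
    (hfin : X.Finite) (huX : u ∉ X) (m : Fin 4)
    (honly : ∀ x ∈ X, (discreteDomainGraph E.Ω E.δ).Adj u x → x = u + cornerUnit m)
    (hsep : ∀ w ∈ E.zdBoundary, w ∉ X → w ≠ u → dist (meshPoint E.δ w) (meshPoint E.δ u) ≤ E.δ →
      ∀ x ∈ X, ¬ (discreteDomainGraph E.Ω E.δ).Adj w x)
    (hvalid : ¬ (E.IsInnerFace (faceAt u m) ∧ E.IsInnerFace (faceAt u (m + 3))))
    (hρv : infDist (meshPoint E.δ (u + cornerUnit m)) (frontier E.Ω) ≤ E.δ) :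
    ¬ closedBall (meshPoint E.δ u) (infDist (meshPoint E.δ u) (frontier E.Ω)) ⊆
      ⋃ x ∈ X, closedBall (meshPoint E.δ x) (infDist (meshPoint E.δ x) (frontier E.Ω)) := by
  intro hcov
  set δ := E.δ with hδdef
  have huD : u ∈ meshDomain E.Ω δ := E.zdBoundary_subset_meshDomain hu
  -- directional forcing in the two far diagonal directions
  have hfar : ∀ k : Fin 4, (k = m + 1 ∨ k = m + 2) →
      u + (cornerUnit k + cornerUnit (k + 1)) ∈ X ∧ ball (meshPoint δ (u + (cornerUnit k + cornerUnit (k + 1)))) (Real.sqrt 2 * δ) ⊆ E.Ω := by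
    intro k hk
    refine add_diag_mem_of_cover hΩ hδ hu hX hfin huX hcov k fun x hx hadj s hs _ => ?_
    rw [honly x hx hadj]
    exact infDist_lt_dist_far_diag hδ u m hρv hk hs
  obtain ⟨hz1, hball1⟩ := hfar (m + 1) (Or.inl rfl)
  obtain ⟨hz2, hball2⟩ := hfar (m + 2) (Or.inr rfl)
  have hne : ∀ (k : Fin 4) (i : Fin 2), u i ≠ (u + (cornerUnit k + cornerUnit (k + 1))) i := fun k i h =>
    diag_apply_ne_zero k i (by rw [Pi.add_apply] at h; omega)
  -- the two far faces at `u` are inner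
  have hF1 : E.IsInnerFace (faceAt u (m + 1)) :=
    isInnerFace_of_corner_ball hδ (isCorner_faceAt u (m + 1)) (isCorner_add_diag_faceAt u (m + 1))
      (hne (m + 1)) huD (E.zdBoundary_subset_meshDomain (hX hz1)) hball1
  have hF2 : E.IsInnerFace (faceAt u (m + 2)) :=
    isInnerFace_of_corner_ball hδ (isCorner_faceAt u (m + 2)) (isCorner_add_diag_faceAt u (m + 2))
      (hne (m + 2)) huD (E.zdBoundary_subset_meshDomain (hX hz2)) hball2
  -- a perpendicular neighbour `w` of `u`, cornering an inner far face together with a far diagonal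
  -- site of `X`, is off `zdBoundary`
  have key : ∀ (w z : Site 2) (F : Site 2), E.IsInnerFace F → IsCorner u F → IsCorner w F →
      IsCorner z F → (zdGraph 2).Adj u w → (zdGraph 2).Adj w z → z ∈ X → w ≠ u + cornerUnit m →
      w ∉ E.zdBoundary := by
    intro w z F hF huF hwF hzF huw hwz hzX hwv hwb
    have hadj_uw : (discreteDomainGraph E.Ω δ).Adj u w := hF u w huF hwF huw
    have hadj_wz : (discreteDomainGraph E.Ω δ).Adj w z := hF w z hwF hzF hwz
    by_cases hwX : w ∈ X
    · exact hwv (honly w hwX hadj_uw)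
    · refine hsep w hwb hwX huw.ne.symm ?_ z hzX hadj_wz
      rw [dist_comm, dist_meshPoint_of_adj huw, abs_of_pos hδ]
  -- `w₊ = u + cornerUnit (m+1)` with the face `m+1` and the diagonal site `u + (cornerUnit (m+1) + cornerUnit ((m+1) + 1))`
  have hw1 : u + cornerUnit (m + 1) ∉ E.zdBoundary := by
    refine key _ (u + (cornerUnit (m + 1) + cornerUnit ((m + 1) + 1))) _ hF1 (isCorner_faceAt u (m + 1))
      ((isCorner_add_faceAt_iff u (m + 1) (m + 1)).2 (Or.inl rfl)) (isCorner_add_diag_faceAt u (m + 1))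
      (zdGraph_adj_add_cornerUnit u (m + 1)) ?_ hz1 ?_
    · rw [diag_succ, ← add_assoc]; exact zdGraph_adj_add_cornerUnit _ _
    · intro h; exact fin4_add_one_ne m (cornerUnit_injective (add_left_cancel h))
  -- `w₋ = u + cornerUnit (m+3)` with the face `m+2` and the diagonal site `u + (cornerUnit (m+2) + cornerUnit ((m+2) + 1))`
  have hw3 : u + cornerUnit (m + 3) ∉ E.zdBoundary := by
    refine key _ (u + (cornerUnit (m + 2) + cornerUnit ((m + 2) + 1))) _ hF2 (isCorner_faceAt u (m + 2))
      ((isCorner_add_faceAt_iff u (m + 3) (m + 2)).2 (Or.inr (fin4_add_three_add_three m).symm))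
      (isCorner_add_diag_faceAt u (m + 2)) (zdGraph_adj_add_cornerUnit u (m + 3)) ?_ hz2 ?_
    · rw [diag_add_two, add_comm (cornerUnit (m + 2)), ← add_assoc]
      exact zdGraph_adj_add_cornerUnit _ _
    · intro h; exact fin4_add_three_ne m (cornerUnit_injective (add_left_cancel h))
  -- hence all faces around `w₊` and `w₋` are inner, including the two faces of the cut edge
  have hm : E.IsInnerFace (faceAt u m) := by
    -- `faceAt u (m+1)` is a face at `w₊`, so is `faceAt u m`
    have h1 : faceAt u (m + 1) = faceAt (u + cornerUnit (m + 1)) (m + 2) := by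
      rw [← fin4_add_one_add_one, faceAt_add_unit_succ]
    obtain ⟨j, hj⟩ := exists_faceAt_of_isCorner
      ((isCorner_add_faceAt_iff u (m + 1) m).2 (Or.inr (fin4_add_one_add_three m).symm))
    rw [hj]
    exact isInnerFace_faceAt_of_not_mem_zdBoundary hw1 (k := m + 2) (h1 ▸ hF1) j
  have hm3 : E.IsInnerFace (faceAt u (m + 3)) := by
    obtain ⟨j', hj'⟩ := exists_faceAt_of_isCorner
      ((isCorner_add_faceAt_iff u (m + 3) (m + 2)).2 (Or.inr (fin4_add_three_add_three m).symm))
    obtain ⟨j, hj⟩ := exists_faceAt_of_isCorner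
      ((isCorner_add_faceAt_iff u (m + 3) (m + 3)).2 (Or.inl rfl))
    rw [hj]
    exact isInnerFace_faceAt_of_not_mem_zdBoundary hw3 (k := j') (hj' ▸ hF2) j
  exact hvalid ⟨hm, hm3⟩

end Summit.CriticalPhenomena.CardyFormulaZ2.Theorems.DiscretisationFamilyExists

end
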